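import Summits.AtomisticToContinuum.Crystallization.Theses.FreeSplittingCertificates
import Summits.AtomisticToContinuum.Crystallization.Theorems.FreeSplittingCertificatesFreePairSplitting
import Literature.MathematicalPhysics.StatisticalMechanics.LennardJonesClusters
import Summits.AtomisticToContinuum.Crystallization.Theorems.FreeSplittingCertificatesStrictSplittingRuleDefs

/-!
# `FreeSplittingCertificates.ApproxFiniteRangeSplitting` (stmt-AtomisticToContinuum-12562, crux r5) — PROVED

LANDING COPY of the decomp-a2c · lens-1 · g38 node `SplittingDeficitLadder` (v3), namespace moved from
`…Theses.SplittingDeficitLadder` to `…Theorems.FreeSplittingCertificatesApproxFiniteRangeSplitting`; nothing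
else changed.  The item is closed by
`theorem approxFiniteRangeSplitting_holds : FreeSplittingCertificates.ApproxFiniteRangeSplitting` (§10;
axioms `propext, Classical.choice, Quot.sound`).  Mechanism: `FreePairSplitting` (tree theorem, stmt-12563)
certificates on the blocks of a cube partition of side `L = R/√3`, centroid-normalised and Bochner/Haar-averaged
over the cube offset (§9), plus the Lennard-Jones tail bound `½ Σ_j V⁻(r_ij)·min(1, √3 r_ij/L) ≤ (125√3/6)·δ⁻⁵/L`
(§4); explicit radius `R(δ,ε) = (125/2)·δ⁻⁵/ε + 1` (`ruleFloor_explicit_radius`).  The node text follows.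

# SplittingDeficitLadder — decomp-a2c · lens-1 (grading / quantitative ladder) · g38 NODE

**v2/v3 ADDENDUM (same generation, 2026-08-31). P2 `BlockAveragedRule` is now PROVED (§9,
`P2.blockAveragedRule_holds`: Bochner/Haar average over cube offsets of centroid-normalised block
certificates, change of variables `c ↦ c − v` for complementarity, slab volume bound for the floor;
0 sorry, axioms standard), hence the TARGET stmt-AtomisticToContinuum-12562
`FreeSplittingCertificates.ApproxFiniteRangeSplitting` is PROVED BY NAME (§10,
`approxFiniteRangeSplitting_holds`) and `RateRung 1` holds outright (`rateRung_one_holds`). In the v1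
text below (§0–§8, unchanged) read "KNOWN-type ⟸ P2" as "PROVED"; §0.5 (1) is superseded: no
retriage of 12562 is needed — hands land §1–§6 + §9–§10 as a `Theorems/` file whose

(… module docstring of record continues in the lens file HOME/decomp-a2c-lens-1/g38/land/FreeSplittingCertificatesApproxFiniteRangeSplitting.lean,
sha256 6ca014fa; this landing is SPLIT at section boundaries for the 400-line rule by prover hand 1 (decomp-a2c gen 12): parts
`…ApproxFiniteRangeSplitting` (§1–§3) → `…B` (§4–§7) → `…P2` (§9 §A–§C) → `…P2D` (§D–§E) → `…P2F` (§F–§G) → `…Holds` (§10–§11,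
closes stmt-AtomisticToContinuum-12562); declarations byte-identical, namespaces unchanged.)
-/

namespace Summit.AtomisticToContinuum.Crystallization.Theorems.FreeSplittingCertificatesApproxFiniteRangeSplitting

open scoped BigOperators
open Literature.MathematicalPhysics.StatisticalMechanics
open Summit.AtomisticToContinuum.Crystallization.Theses.FreeSplittingCertificates

noncomputable section

/-! ## §1 The matrix of the route's splitting ladder, typed once

All four objects below are VERBATIM sub-expressions of the route decls `FiniteRangeSplitting`
(12559), `StrictSplittingRule` (12560), `ApproxFiniteRangeSplitting` (12562), `SlackDensity`
(12564): nothing is re-typed, the route decls are recovered BY NAME in §2. -/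

/-- Fekete's constant `e_∞ = ⨅_M E(M+1)/(M+1)` exactly as spelled in the route file
(`BlancLewin2015_8_holds`, proved in the tree, identifies it with `lim E(N)/N`). -/
def eInf : ℝ :=
  ⨅ M : ℕ, groundStateEnergy lennardJones 3 (M + 1) / ((M + 1 : ℕ) : ℝ)

/-- A pair-splitting RULE is boxed and complementary (route header: `0 ≤ Φ ≤ 1`,
`Φ(v,T) + Φ(-v, T - v) = 1`). Verbatim from the route decls. -/
def RuleBox (Φ : EuclideanSpace ℝ (Fin 3) → Finset (EuclideanSpace ℝ (Fin 3)) → ℝ) : Prop :=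
  (∀ v T, 0 ≤ Φ v T ∧ Φ v T ≤ 1) ∧ (∀ v T, v ≠ 0 → Φ v T + Φ (-v) (T.image fun u => u - v) = 1)

/-- The two-endpoint pattern of radius `R` handed to the rule for the bond `(i,j)`, recentred at
`x i` (verbatim from the route decls). -/
def bondPattern {N : ℕ} (x : Fin N → EuclideanSpace ℝ (Fin 3)) (R : ℝ) (i j : Fin N) :
    Finset (EuclideanSpace ℝ (Fin 3)) :=
  (Finset.univ.filter fun l => dist (x l) (x i) ≤ R ∨ dist (x l) (x j) ≤ R).image fun l => x l - x i

/-- The `Φ`-weighted Lennard-Jones site energy of site `i` at rule radius `R`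
(verbatim from the route decls). -/
def weightedSiteEnergy {N : ℕ} (x : Fin N → EuclideanSpace ℝ (Fin 3)) (R : ℝ)
    (Φ : EuclideanSpace ℝ (Fin 3) → Finset (EuclideanSpace ℝ (Fin 3)) → ℝ) (i : Fin N) : ℝ :=
  ∑ j ∈ Finset.univ.erase i, Φ (x j - x i) (bondPattern x R i j) * lennardJones (dist (x i) (x j))

/-- `δ`-separation of a finite configuration (verbatim hypothesis of the route decls). -/
def Separated {N : ℕ} (δ : ℝ) (x : Fin N → EuclideanSpace ℝ (Fin 3)) : Prop :=
  ∀ i j, i ≠ j → δ ≤ dist (x i) (x j)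

/-- FEASIBILITY of the rule `Φ` at radius `R` with FLOOR `f` on all `δ`-separated finite
configurations: every weighted site energy is `≥ f`. The route's rungs are the floors
`f = e_∞` (12559, and the feasibility half of 12560) and `f = e_∞ - ε` (12562). -/
def Feasible (δ R : ℝ) (Φ : EuclideanSpace ℝ (Fin 3) → Finset (EuclideanSpace ℝ (Fin 3)) → ℝ)
    (f : ℝ) : Prop :=
  ∀ (N : ℕ) (x : Fin N → EuclideanSpace ℝ (Fin 3)), Separated δ x →
    ∀ i : Fin N, f ≤ weightedSiteEnergy x R Φ i

/-- THE GRADED MATRIX ENTRY: some boxed complementary rule of radius `R` is feasible with floor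
`f` on `δ`-separated configurations. The whole ladder of this node is the function
`(δ, R, f) ↦ RuleFloor δ R f`; it is antitone in `f` and monotone in `R` (§3). -/
def RuleFloor (δ R f : ℝ) : Prop :=
  ∃ Φ : EuclideanSpace ℝ (Fin 3) → Finset (EuclideanSpace ℝ (Fin 3)) → ℝ,
    RuleBox Φ ∧ Feasible δ R Φ f

/-- THE RATE RUNG `k` (the new, graded statements between the route's rungs r5 and r2):
for every hard core `δ` there is a constant `C(δ) ≥ 0` such that at EVERY radius `R ≥ 1` some
rule of radius `R` has floor `e_∞ - C/R^k`. `k = 1` is the averaging rate (§5–§6);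
`FiniteRangeSplitting` (floor `e_∞` at one finite radius) implies every rung (§3), and every rung
`k ≥ 1` implies `ApproxFiniteRangeSplitting` (§3). -/
def RateRung (k : ℕ) : Prop :=
  ∀ δ : ℝ, 0 < δ → ∃ C : ℝ, 0 ≤ C ∧ ∀ R : ℝ, 1 ≤ R → RuleFloor δ R (eInf - C / R ^ k)

/-! ## §2 The route's rungs BY NAME -/

/-- r2 = 12559 `FiniteRangeSplitting` is the floor-`e_∞` entry of the matrix at some finite
radius, for every hard core. -/
theorem finiteRangeSplitting_iff :
    FiniteRangeSplitting ↔ ∀ δ : ℝ, 0 < δ → ∃ R : ℝ, 0 < R ∧ RuleFloor δ R eInf := by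
  constructor
  · intro h δ hδ
    obtain ⟨R, Φ, hR, hbox, hfeas⟩ := h δ hδ
    exact ⟨R, hR, Φ, hbox, hfeas⟩
  · intro h δ hδ
    obtain ⟨R, hR, Φ, hbox, hfeas⟩ := h δ hδ
    exact ⟨R, Φ, hR, hbox, hfeas⟩

/-- r5 = 12562 `ApproxFiniteRangeSplitting` is the floor-`(e_∞ - ε)` entry at some finite
radius, for every hard core and every `ε > 0`. -/
theorem approxFiniteRangeSplitting_iff :
    ApproxFiniteRangeSplitting ↔
      ∀ δ : ℝ, 0 < δ → ∀ ε : ℝ, 0 < ε → ∃ R : ℝ, 0 < R ∧ RuleFloor δ R (eInf - ε) := by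
  constructor
  · intro h δ hδ ε hε
    obtain ⟨R, Φ, hR, hbox, hfeas⟩ := h δ hδ ε hε
    exact ⟨R, hR, Φ, hbox, hfeas⟩
  · intro h δ hδ ε hε
    obtain ⟨R, hR, Φ, hbox, hfeas⟩ := h δ hδ ε hε
    exact ⟨R, Φ, hR, hbox, hfeas⟩

/-- The feasibility half of r3 = 12560 `StrictSplittingRule` is again the floor-`e_∞` entry
(the strictness half is the on-path content audited by lens-6 g28; not touched here). -/
theorem ruleFloor_of_strictSplittingRule (h : StrictSplittingRule) :
    ∀ δ : ℝ, 0 < δ → ∃ R : ℝ, 0 < R ∧ RuleFloor δ R eInf := by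
  intro δ hδ
  obtain ⟨R, Φ, a, t, hR, -, -, hbox, hfeas, -⟩ := h δ hδ
  exact ⟨R, hR, Φ, hbox, hfeas⟩


/-! ## §3 Ladder algebra (all PROVED): antitone in the floor, monotone in the radius, the crude
`½`-rule floor from the shell sum, and the placement of the route's rungs on the rate axis:
`FiniteRangeSplitting → RateRung k → RateRung k' → ApproxFiniteRangeSplitting` (`k' ≤ k`, `1 ≤ k'`). -/
/-- Auxiliary (lens-1 g38 `ApproxFiniteRangeSplitting` ladder). [folklore] -/

theorem feasible_antitone {δ R f f' : ℝ}
    {Φ : EuclideanSpace ℝ (Fin 3) → Finset (EuclideanSpace ℝ (Fin 3)) → ℝ}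
    (hff : f' ≤ f) (h : Feasible δ R Φ f) : Feasible δ R Φ f' :=
  fun N x hx i => hff.trans (h N x hx i)
/-- Auxiliary (lens-1 g38 `ApproxFiniteRangeSplitting` ladder). [folklore] -/

theorem ruleFloor_antitone {δ R f f' : ℝ} (hff : f' ≤ f) (h : RuleFloor δ R f) :
    RuleFloor δ R f' := by
  obtain ⟨Φ, hbox, hfeas⟩ := h
  exact ⟨Φ, hbox, feasible_antitone hff hfeas⟩

/-- A `δ`-separated configuration with `δ > 0` is injective. -/
theorem injective_of_separated {N : ℕ} {δ : ℝ} (hδ : 0 < δ)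
    {x : Fin N → EuclideanSpace ℝ (Fin 3)} (hx : Separated δ x) : Function.Injective x := by
  intro i j hij
  by_contra hne
  have h := hx i j hne
  rw [hij, dist_self] at h
  exact absurd h (not_le.2 hδ)

/-- Restricting a radius-`R'` pattern to radius `R ≤ R'` from the pattern alone: keep the
relative positions within `R` of the origin or of `v`. -/
def restrictPattern (R : ℝ) (v : EuclideanSpace ℝ (Fin 3))
    (T : Finset (EuclideanSpace ℝ (Fin 3))) : Finset (EuclideanSpace ℝ (Fin 3)) :=
  T.filter fun u => ‖u‖ ≤ R ∨ dist u v ≤ R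
/-- Auxiliary (lens-1 g38 `ApproxFiniteRangeSplitting` ladder). [folklore] -/

theorem restrictPattern_bondPattern {N : ℕ} (x : Fin N → EuclideanSpace ℝ (Fin 3)) {R R' : ℝ}
    (hRR : R ≤ R') (i j : Fin N) :
    restrictPattern R (x j - x i) (bondPattern x R' i j) = bondPattern x R i j := by
  classical
  unfold restrictPattern bondPattern
  rw [Finset.filter_image]
  congr 1
  ext l
  simp only [Finset.mem_filter, Finset.mem_univ, true_and]
  have h1 : ‖x l - x i‖ = dist (x l) (x i) := (dist_eq_norm (x l) (x i)).symm
  have h2 : dist (x l - x i) (x j - x i) = dist (x l) (x j) := by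
    rw [dist_eq_norm, dist_eq_norm]; congr 1; abel
  rw [h1, h2]
  constructor
  · rintro ⟨-, h⟩; exact h
  · intro h
    refine ⟨?_, h⟩
    rcases h with h | h
    · exact Or.inl (h.trans hRR)
    · exact Or.inr (h.trans hRR)
/-- Auxiliary (lens-1 g38 `ApproxFiniteRangeSplitting` ladder). [folklore] -/

theorem restrictPattern_shift (R : ℝ) (v : EuclideanSpace ℝ (Fin 3))
    (T : Finset (EuclideanSpace ℝ (Fin 3))) :
    restrictPattern R (-v) (T.image fun u => u - v) =
      (restrictPattern R v T).image fun u => u - v := by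
  classical
  unfold restrictPattern
  rw [Finset.filter_image]
  congr 1
  ext u
  simp only [Finset.mem_filter, and_congr_right_iff]
  intro _
  have h1 : ‖u - v‖ = dist u v := (dist_eq_norm u v).symm
  have h2 : dist (u - v) (-v) = ‖u‖ := by rw [dist_eq_norm]; congr 1; abel
  rw [h1, h2]
  exact Or.comm

/-- MONOTONE IN THE RADIUS: a rule of radius `R` is (re-packaged as) a rule of every radius
`R' ≥ R`, with the same weights on every realised bond. -/
theorem ruleFloor_mono_radius {δ R R' f : ℝ} (hRR : R ≤ R') (h : RuleFloor δ R f) :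
    RuleFloor δ R' f := by
  obtain ⟨Φ, ⟨hbox, hcomp⟩, hfeas⟩ := h
  refine ⟨fun v T => Φ v (restrictPattern R v T), ⟨fun v T => hbox v _, ?_⟩, ?_⟩
  · intro v T hv
    have := hcomp v (restrictPattern R v T) hv
    rwa [← restrictPattern_shift] at this
  · intro N x hx i
    have h := hfeas N x hx i
    unfold weightedSiteEnergy at h ⊢
    simpa only [restrictPattern_bondPattern x hRR] using h

/-- THE CRUDE FLOOR (shell sum, tree lemma `sum_inv_pow_six_le`): the symmetric rule `Φ ≡ ½`
has floor `-(125/6)·δ⁻⁶` at every radius on `δ`-separated configurations. -/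
theorem ruleFloor_half {δ : ℝ} (hδ : 0 < δ) (R : ℝ) :
    RuleFloor δ R (-(125 / 6) * δ⁻¹ ^ 6) := by
  refine ⟨fun _ _ => 1 / 2, ⟨fun _ _ => by norm_num, fun _ _ _ => by norm_num⟩, ?_⟩
  intro N x hx i
  unfold weightedSiteEnergy
  have hsep : ∀ k l, k ≠ l → δ ≤ dist (x k) (x l) := hx
  have hsum := sum_inv_pow_six_le x hδ hsep i
  have hterm : ∀ j ∈ Finset.univ.erase i,
      -(1 / 12) * (dist (x i) (x j))⁻¹ ^ 6 ≤ 1 / 2 * lennardJones (dist (x i) (x j)) := by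
    intro j _
    unfold lennardJones
    have h0 : 0 ≤ ((dist (x i) (x j))⁻¹) ^ 12 := by positivity
    nlinarith [h0]
  calc -(125 / 6) * δ⁻¹ ^ 6 = -(1 / 12) * (250 * δ⁻¹ ^ 6) := by ring
    _ ≤ -(1 / 12) * ∑ j ∈ Finset.univ.erase i, (dist (x i) (x j))⁻¹ ^ 6 := by
        have : (0 : ℝ) ≤ 1 / 12 := by norm_num
        nlinarith [hsum]
    _ = ∑ j ∈ Finset.univ.erase i, -(1 / 12) * (dist (x i) (x j))⁻¹ ^ 6 := by
        rw [Finset.mul_sum]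
    _ ≤ ∑ j ∈ Finset.univ.erase i, 1 / 2 * lennardJones (dist (x i) (x j)) :=
        Finset.sum_le_sum hterm

/-- r2 ABOVE EVERY RATE RUNG: `FiniteRangeSplitting → RateRung k` for every `k`
(radius monotonicity above the witness radius, the crude floor below it). -/
theorem rateRung_of_finiteRangeSplitting (h : FiniteRangeSplitting) (k : ℕ) : RateRung k := by
  intro δ hδ
  obtain ⟨R₀, hR₀, hfloor⟩ := finiteRangeSplitting_iff.1 h δ hδ
  set B : ℝ := (125 / 6) * δ⁻¹ ^ 6 with hB
  refine ⟨max 0 ((eInf + B) * R₀ ^ k), le_max_left _ _, fun R hR => ?_⟩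
  have hRpos : 0 < R := by linarith
  have hRk : 0 < R ^ k := pow_pos hRpos k
  rcases le_or_gt R₀ R with hle | hlt
  · refine ruleFloor_antitone ?_ (ruleFloor_mono_radius hle hfloor)
    have : 0 ≤ max 0 ((eInf + B) * R₀ ^ k) / R ^ k := div_nonneg (le_max_left _ _) hRk.le
    linarith
  · refine ruleFloor_antitone ?_ (ruleFloor_half hδ R)
    -- need: eInf - C / R^k ≤ -B, i.e. eInf + B ≤ C / R^k
    have hR0k : 0 < R₀ ^ k := pow_pos hR₀ k
    have hpow : R ^ k ≤ R₀ ^ k := pow_le_pow_left₀ hRpos.le hlt.le k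
    have h1 : (eInf + B) * R ^ k ≤ max 0 ((eInf + B) * R₀ ^ k) := by
      rcases le_or_gt 0 (eInf + B) with hpos | hneg
      · exact (mul_le_mul_of_nonneg_left hpow hpos).trans (le_max_right _ _)
      · exact (mul_nonpos_iff.2 (Or.inr ⟨hneg.le, hRk.le⟩)).trans (le_max_left _ _)
    have h2 : eInf + B ≤ max 0 ((eInf + B) * R₀ ^ k) / R ^ k := by
      rw [le_div_iff₀ hRk]; exact h1
    have hB' : -(125 / 6) * δ⁻¹ ^ 6 = -B := by rw [hB]; ring
    rw [hB']
    linarith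

/-- RATE RUNGS ARE NESTED: `RateRung k → RateRung k'` for `k' ≤ k` (radii `R ≥ 1`). -/
theorem rateRung_mono {k k' : ℕ} (hk : k' ≤ k) (h : RateRung k) : RateRung k' := by
  intro δ hδ
  obtain ⟨C, hC, hR⟩ := h δ hδ
  refine ⟨C, hC, fun R hR1 => ruleFloor_antitone ?_ (hR R hR1)⟩
  have hRpos : 0 < R := by linarith
  have hpow : R ^ k' ≤ R ^ k := pow_le_pow_right₀ hR1 hk
  have : C / R ^ k ≤ C / R ^ k' :=
    div_le_div_of_nonneg_left hC (pow_pos hRpos k') hpow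
  linarith

/-- EVERY RATE RUNG `k ≥ 1` IS ABOVE r5: `RateRung k → ApproxFiniteRangeSplitting`
(BY NAME). -/
theorem approxFiniteRangeSplitting_of_rateRung {k : ℕ} (hk : 1 ≤ k) (h : RateRung k) :
    ApproxFiniteRangeSplitting := by
  rw [approxFiniteRangeSplitting_iff]
  intro δ hδ ε hε
  obtain ⟨C, hC, hR⟩ := h δ hδ
  set R : ℝ := max 1 (C / ε + 1) with hRdef
  have hR1 : 1 ≤ R := le_max_left _ _
  have hRpos : 0 < R := by linarith
  refine ⟨R, hRpos, ruleFloor_antitone ?_ (hR R hR1)⟩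
  -- C / R^k ≤ ε
  have hRk : R ≤ R ^ k := le_self_pow₀ hR1 (by omega)
  have hRkpos : 0 < R ^ k := pow_pos hRpos k
  have h1 : C / R ^ k ≤ C / R := div_le_div_of_nonneg_left hC hRpos hRk
  have h2 : C / R ≤ ε := by
    rw [div_le_iff₀ hRpos]
    have : C / ε + 1 ≤ R := le_max_right _ _
    have h3 : C / ε * ε = C := div_mul_cancel₀ C hε.ne'
    nlinarith
  linarith

/-- Hence r2 → r5 factors through the whole rate axis (the route's `Ladder`, second clause,
re-proved through `RateRung 1`). -/
theorem approx_of_finiteRange_via_rate (h : FiniteRangeSplitting) : ApproxFiniteRangeSplitting :=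
  approxFiniteRangeSplitting_of_rateRung le_rfl (rateRung_of_finiteRangeSplitting h 1)

end

end Summit.AtomisticToContinuum.Crystallization.Theorems.FreeSplittingCertificatesApproxFiniteRangeSplitting
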